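import Summits.SmoothPoincare4.SmoothPoincare4.Theorems.CylinderEntropyCylinderRungTwoFluxIdentityMultiplicity
import HarnessLib

/-!
# Flux identity, part 4: nullity of the critical shadow; the radial normalisation onto `N`

Part of the proof of the stub `stub_fluxIdentity` (the FLUX IDENTITY `|∫_M ν₅ d(ι^*μH⁴)| = μH⁴(S⁴)`
for connected compact cross-sections of `N = S⁴ × ℝ ⊂ ℝ⁶`) of line `killing-flux` of the crux
`CylinderEntropy.CylinderRungTwo` (stmt-SmoothPoincare4-7631); see the final file
`CylinderEntropyCylinderRungTwoFluxIdentity.lean` for the overall argument. Everything here is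
proved (no named facts); theorems only.

* `hausdorffMeasure_shadow_critical_eq_zero` — `μHE[4] (shadow {ν₅ = 0}) = 0` (finite cover by
  compact chart pieces, cones, polar coordinates: tree `comap_euclideanHausdorff_eq_toSphere_general`);
* the radial normalisation `nrm : z ↦ (z'/‖z'‖, z₅)` (inline notation) and the push-off estimate
  `‖nrm(u + tτ) - (u + tτ)‖ ≤ t²‖τ‖²` for `u ∈ N`, `τ` tangent to `N` (`norm_nrm_sub_le`);
* `pushoff_endgame` — the norm arithmetic of the push-off lemma.
-/

-- the prescribed namespace `Summit.SmoothPoincare4.SmoothPoincare4.…` repeats `SmoothPoincare4`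
set_option linter.dupNamespace false

noncomputable section

open MeasureTheory Set Function Filter Module
open scoped Manifold ContDiff ENNReal Topology RealInnerProductSpace NNReal

namespace Summit.SmoothPoincare4.SmoothPoincare4.Theorems.CylinderRungTwo.KillingFlux

open Literature.Geometry.Riemannian
open Literature.Geometry.Lorentzian Literature.Geometry.Lorentzian.PseudoRiemannianMetric
open Literature.Geometry.Riemannian.SphericalCylinderEntropy (truncL truncL_apply lipschitz_truncL
  hausdorffMeasure_sphere_four_pos hausdorffMeasure_sphere_four_lt_top)
open Literature.Geometry.Manifold.CylinderSlice (axis castSucc_ne_five)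

section CriticalNull

open Literature.Geometry.GeometricMeasureTheory

open scoped Pointwise

variable {M : Type} [TopologicalSpace M] [ChartedSpace (EuclideanSpace ℝ (Fin 4)) M] [IsManifold (𝓡 4) ∞ M]

variable [CompactSpace M]

/-- **The shadow of the critical set is `𝓗⁴`-null**: `μHE[4] (shadow {ν₅ = 0}) = 0`. Cover the
compact critical set by finitely many compact chart pieces; for each, the cone over its shadow is
Lebesgue-null in `ℝ⁵` (`volume_cone_shadow_critical_eq_zero`), hence its shadow is null for the
polar surface measure `volume.toSphere`, which is `μHE[4]` on the unit sphere of `ℝ⁵` (tree: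
`comap_euclideanHausdorff_eq_toSphere_general`). [folklore] -/
theorem hausdorffMeasure_shadow_critical_eq_zero {ι ν : M → (EuclideanSpace ℝ (Fin 6))}
    (hι : Manifold.IsSmoothEmbedding (𝓡 4) (𝓡 6) ∞ ι)
    (hιN : ∀ x, ∑ i : Fin 5, ι x (Fin.castSucc i) ^ 2 = 1)
    (hνc : Continuous ν) (hνn : (euclideanMetric (EuclideanSpace ℝ (Fin 6))).IsUnitNormal (𝓡 4) ι ν 1)
    (hνt : ∀ x, ∑ i : Fin 5, ν x (Fin.castSucc i) * ι x (Fin.castSucc i) = 0) :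
    (μHE[4] : Measure (EuclideanSpace ℝ (Fin 5))) ((fun x => truncL (ι x)) '' {x | ν x 5 = 0}) = 0 := by
  haveI : LocallyCompactSpace M := ChartedSpace.locallyCompactSpace (EuclideanSpace ℝ (Fin 4)) M
  set σ : M → (EuclideanSpace ℝ (Fin 5)) := fun x => truncL (ι x) with hσ
  have hσc : Continuous σ := truncL.continuous.comp hι.contMDiff.continuous
  have hM0c : IsClosed {x : M | ν x 5 = 0} :=
    isClosed_eq ((EuclideanSpace.proj (5 : Fin 6)).continuous.comp hνc) continuous_const
  -- a finite cover by compact chart pieces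
  have hK : ∀ x : M, ∃ K : Set M, IsCompact K ∧ x ∈ interior K ∧ K ⊆ (extChartAt (𝓡 4) x).source :=
    fun x => exists_compact_subset (isOpen_extChartAt_source x) (mem_extChartAt_source x)
  choose K hKc hKx hKs using hK
  obtain ⟨T, hT⟩ := isCompact_univ.elim_finite_subcover (fun x => interior (K x))
    (fun x => isOpen_interior) (fun x _ => mem_iUnion.2 ⟨x, hKx x⟩)
  -- each piece has null shadow
  have hpiece : ∀ x : M, (μHE[4] : Measure (EuclideanSpace ℝ (Fin 5))) (σ '' ({y | ν y 5 = 0} ∩ K x)) = 0 := by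
    intro x
    set Z := {y | ν y 5 = 0} ∩ K x with hZ
    have hZc : IsCompact Z := (hKc x).inter_left hM0c
    have hBc : IsCompact (σ '' Z) := hZc.image hσc
    have hBm : MeasurableSet (σ '' Z) := hBc.isClosed.measurableSet
    have hBS : σ '' Z ⊆ Metric.sphere (0 : (EuclideanSpace ℝ (Fin 5))) 1 := by
      rintro _ ⟨z, -, rfl⟩
      rw [mem_sphere_zero_iff_norm, EuclideanSpace.norm_eq, Real.sqrt_eq_one]
      simpa [hσ, truncL_apply, Real.norm_eq_abs, sq_abs] using hιN z
    have hcone := volume_cone_shadow_critical_eq_zero hι hιN hνn hνt x (Z := Z)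
      (inter_subset_right.trans (hKs x)) (fun y hy => hy.1)
    -- polar coordinates: `toSphere` of the shadow vanishes
    set A : Set (Metric.sphere (0 : (EuclideanSpace ℝ (Fin 5))) 1) := Subtype.val ⁻¹' (σ '' Z) with hA
    have hAm : MeasurableSet A := measurable_subtype_coe hBm
    have hvalA : Subtype.val '' A = σ '' Z := by
      rw [hA, Subtype.image_preimage_coe, inter_eq_self_of_subset_right hBS]
    have htS : (volume : Measure (EuclideanSpace ℝ (Fin 5))).toSphere A = 0 := by
      rw [Measure.toSphere_apply' _ hAm, hvalA]
      change _ * (volume : Measure (EuclideanSpace ℝ (Fin 5))) (Ioo (0 : ℝ) 1 • ((fun x => truncL (ι x)) '' Z)) = 0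
      rw [hcone, mul_zero]
    have hcomap := Literature.MeasureTheory.Hausdorff.comap_euclideanHausdorff_eq_toSphere_general
      (E := (EuclideanSpace ℝ (Fin 5))) (d := 4) (by simp) (by norm_num)
    have h1 : (Measure.comap Subtype.val (μHE[4] : Measure (EuclideanSpace ℝ (Fin 5)))) A = 0 := by
      rw [hcomap, htS]
    rwa [(MeasurableEmbedding.subtype_coe Metric.isClosed_sphere.measurableSet).comap_apply, hvalA] at h1
  -- assemble
  have hcover : {x : M | ν x 5 = 0} ⊆ ⋃ x ∈ T, ({y | ν y 5 = 0} ∩ K x) := by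
    intro y hy
    have := hT (mem_univ y)
    simp only [mem_iUnion] at this
    obtain ⟨x, hxT, hyx⟩ := this
    exact mem_biUnion hxT ⟨hy, interior_subset hyx⟩
  refine le_antisymm ?_ (zero_le (α := ℝ≥0∞))
  calc (μHE[4] : Measure (EuclideanSpace ℝ (Fin 5))) (σ '' {x | ν x 5 = 0})
      ≤ (μHE[4] : Measure (EuclideanSpace ℝ (Fin 5))) (⋃ x ∈ T, σ '' ({y | ν y 5 = 0} ∩ K x)) := by
        refine measure_mono ?_
        rw [← image_iUnion₂]
        exact image_mono hcover
    _ ≤ ∑ x ∈ T, (μHE[4] : Measure (EuclideanSpace ℝ (Fin 5))) (σ '' ({y | ν y 5 = 0} ∩ K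
          x)) := measure_biUnion_finset_le _ _
    _ = 0 := Finset.sum_eq_zero fun x _ => hpiece x

end CriticalNull

/-! ## §5 The radial normalisation onto `N` and the push-off estimate -/

section Normalisation

/-- First five coordinates of the normalisation. [folklore] -/
theorem nrm_apply_castSucc (z : (EuclideanSpace ℝ (Fin 6))) (i : Fin 5) :
    ((fun z : EuclideanSpace ℝ (Fin 6) => (‖truncL z‖⁻¹ : ℝ) • (z - z (5 : Fin 6) • (axis : EuclideanSpace ℝ (Fin
          6))) + z (5 : Fin 6) • (axis : EuclideanSpace ℝ (Fin 6))) z) (Fin.castSucc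
          i) = ‖truncL z‖⁻¹ * z (Fin.castSucc i) := by
  simp [axis, castSucc_ne_five i]

/-- The normalisation preserves the height. [folklore] -/
theorem nrm_apply_five (z : (EuclideanSpace ℝ (Fin 6))) : ((fun z : EuclideanSpace ℝ (Fin 6) => (‖truncL z‖⁻¹ : ℝ) •
      (z - z (5 : Fin 6) • (axis : EuclideanSpace ℝ (Fin 6))) + z (5 : Fin 6) • (axis : EuclideanSpace ℝ (Fin 6)))
      z) 5 = z 5 := by
  simp [axis]

/-- `‖truncL z‖² = ∑_{i<5} zᵢ²`. [folklore] -/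
theorem norm_truncL_sq (z : (EuclideanSpace ℝ (Fin 6))) : ‖truncL z‖ ^ 2 = ∑ i : Fin 5, z (Fin.castSucc i) ^ 2 := by
  rw [EuclideanSpace.norm_sq_eq]
  simp [truncL_apply, sq_abs]

/-- The normalisation lands in the cylinder `N`. [folklore] -/
theorem sum_sq_nrm {z : (EuclideanSpace ℝ (Fin 6))} (hz : truncL z ≠ 0) :
    ∑ i : Fin 5, ((fun z : EuclideanSpace ℝ (Fin 6) => (‖truncL z‖⁻¹ : ℝ) • (z - z (5 : Fin 6) • (axis :
          EuclideanSpace ℝ (Fin 6))) + z (5 : Fin 6) • (axis : EuclideanSpace ℝ (Fin 6))) z) (Fin.castSucc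
          i) ^ 2 = 1 := by
  simp only [nrm_apply_castSucc, mul_pow, ← Finset.mul_sum, ← norm_truncL_sq]
  have h : ‖truncL z‖ ≠ 0 := norm_ne_zero_iff.2 hz
  field_simp

/-- The normalisation is the identity on `N`. [folklore] -/
theorem nrm_eq_self {z : (EuclideanSpace ℝ (Fin 6))} (hz : ∑ i : Fin 5, z (Fin.castSucc i) ^ 2 = 1) : (fun z :
      EuclideanSpace ℝ (Fin 6) => (‖truncL z‖⁻¹ : ℝ) • (z - z (5 : Fin 6) • (axis : EuclideanSpace ℝ (Fin 6))) + z
      (5 : Fin 6) • (axis : EuclideanSpace ℝ (Fin 6))) z = z := by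
  have h1 : ‖truncL z‖ = 1 := by
    rw [← Real.sqrt_sq (norm_nonneg _), norm_truncL_sq, hz, Real.sqrt_one]
  simp only [h1, inv_one, one_smul, sub_add_cancel]

/-- The normalisation is continuous off `{z' = 0}`. [folklore] -/
theorem continuousOn_nrm : ContinuousOn (fun z : EuclideanSpace ℝ (Fin 6) => (‖truncL z‖⁻¹ : ℝ) • (z - z (5 : Fin 6)
      • (axis : EuclideanSpace ℝ (Fin 6))) + z (5 : Fin 6) • (axis : EuclideanSpace ℝ (Fin 6))) {z : (EuclideanSpace
      ℝ (Fin 6)) | truncL z ≠ 0} := by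
  have h5 : Continuous fun z : (EuclideanSpace ℝ (Fin 6)) => z (5 : Fin 6) := (EuclideanSpace.proj (5 : Fin
        6)).continuous
  have hq : Continuous fun z : (EuclideanSpace ℝ (Fin 6)) => z - z (5 : Fin 6) • (axis : (EuclideanSpace ℝ (Fin
        6))) :=
    continuous_id.sub (h5.smul continuous_const)
  have hinv : ContinuousOn (fun z : (EuclideanSpace ℝ (Fin 6)) => (‖truncL z‖⁻¹ : ℝ)) {z | truncL z ≠ 0} :=
    (continuous_norm.comp truncL.continuous).continuousOn.inv₀ fun z hz => norm_ne_zero_iff.2 hz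
  exact (hinv.smul hq.continuousOn).add (h5.smul continuous_const).continuousOn

/-- **Push-off estimate.** At a point `u ∈ N` and for a direction `τ` tangent to `N`
(`∑_{i<5} τᵢ uᵢ = 0`), normalising the pushed-off point `u + t τ` moves it by at most `t² ‖τ‖²`:
`‖nrm(u + tτ) − (u + tτ)‖ ≤ t²‖τ‖²` (and `truncL (u + tτ) ≠ 0`). Indeed `‖(u + tτ)'‖² = 1 + t²‖τ'‖²`.
[folklore] -/
theorem norm_nrm_sub_le {u τ : (EuclideanSpace ℝ (Fin 6))} (hu : ∑ i : Fin 5, u (Fin.castSucc i) ^ 2 = 1)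
    (hτ : ∑ i : Fin 5, τ (Fin.castSucc i) * u (Fin.castSucc i) = 0) (t : ℝ) :
    truncL (u + t • τ) ≠ 0 ∧ ‖(fun z : EuclideanSpace ℝ (Fin 6) => (‖truncL z‖⁻¹ : ℝ) • (z - z (5 : Fin 6) • (axis :
          EuclideanSpace ℝ (Fin 6))) + z (5 : Fin 6) • (axis : EuclideanSpace ℝ (Fin 6))) (u + t • τ) - (u + t •
          τ)‖ ≤ t ^ 2 * ‖τ‖ ^ 2 := by
  set z : (EuclideanSpace ℝ (Fin 6)) := u + t • τ with hz
  set ρ : ℝ := ‖truncL z‖ with hρ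
  -- `ρ² = 1 + t² ∑_{i<5} τᵢ²`
  have hρ2 : ρ ^ 2 = 1 + t ^ 2 * ∑ i : Fin 5, τ (Fin.castSucc i) ^ 2 := by
    rw [hρ, norm_truncL_sq]
    have : ∀ i : Fin 5, z (Fin.castSucc i) ^ 2 = u (Fin.castSucc i) ^ 2 +
        2 * t * (τ (Fin.castSucc i) * u (Fin.castSucc i)) + t ^ 2 * τ (Fin.castSucc i) ^ 2 := by
      intro i
      simp only [hz, PiLp.add_apply, PiLp.smul_apply, smul_eq_mul]
      ring
    simp only [this, Finset.sum_add_distrib, ← Finset.mul_sum, hu, hτ, mul_zero, add_zero]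
  have hsum_le : ∑ i : Fin 5, τ (Fin.castSucc i) ^ 2 ≤ ‖τ‖ ^ 2 := by
    rw [EuclideanSpace.norm_sq_eq, Fin.sum_univ_castSucc (f := fun i : Fin 6 => ‖τ i‖ ^ 2)]
    simp only [Real.norm_eq_abs, sq_abs]
    linarith [sq_nonneg (τ (Fin.last 5))]
  have hρ1 : 1 ≤ ρ := by
    have h1 : 1 ≤ ρ ^ 2 := by
      rw [hρ2]
      have : 0 ≤ t ^ 2 * ∑ i : Fin 5, τ (Fin.castSucc i) ^ 2 :=
        mul_nonneg (sq_nonneg _) (Finset.sum_nonneg fun i _ => sq_nonneg _)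
      linarith
    nlinarith [norm_nonneg (truncL z)]
  have hρ0 : 0 < ρ := lt_of_lt_of_le one_pos hρ1
  have hz0 : truncL z ≠ 0 := by
    rw [← norm_ne_zero_iff]; exact hρ0.ne'
  refine ⟨hz0, ?_⟩
  -- `nrm z - z = (ρ⁻¹ - 1) • q` with `q = z - z₅ e₅`, `‖q‖ = ρ`
  set q : (EuclideanSpace ℝ (Fin 6)) := z - z 5 • (axis : (EuclideanSpace ℝ (Fin 6))) with hq
  have hq_norm : ‖q‖ = ρ := by
    have h2 : ‖q‖ ^ 2 = ρ ^ 2 := by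
      rw [hρ, norm_truncL_sq, EuclideanSpace.norm_sq_eq,
        Fin.sum_univ_castSucc (f := fun i : Fin 6 => ‖q i‖ ^ 2)]
      simp [hq, axis, castSucc_ne_five, Real.norm_eq_abs, sq_abs]
    exact (pow_left_inj₀ (norm_nonneg _) hρ0.le two_ne_zero).1 h2
  have hdiff : (fun z : EuclideanSpace ℝ (Fin 6) => (‖truncL z‖⁻¹ : ℝ) • (z - z (5 : Fin 6) • (axis : EuclideanSpace
        ℝ (Fin 6))) + z (5 : Fin 6) • (axis : EuclideanSpace ℝ (Fin 6))) z - z = (ρ⁻¹ - 1) • q := by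
    show (ρ⁻¹ • q + z 5 • (axis : (EuclideanSpace ℝ (Fin 6)))) - z = (ρ⁻¹ - 1) • q
    have : z = q + z 5 • (axis : (EuclideanSpace ℝ (Fin 6))) := by rw [hq, sub_add_cancel]
    conv_lhs => rw [this]
    simp only [sub_smul, one_smul]
    abel_nf
    simp [hq]
  rw [hdiff, norm_smul, hq_norm, Real.norm_eq_abs]
  have hρeq : |ρ⁻¹ - 1| * ρ = ρ - 1 := by
    rw [abs_of_nonpos (by rw [sub_nonpos]; exact inv_le_one_of_one_le₀ hρ1), neg_sub, sub_mul,
      inv_mul_cancel₀ hρ0.ne', one_mul]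
  rw [hρeq]
  have hρsq : ρ - 1 ≤ ρ ^ 2 - 1 := by nlinarith
  calc ρ - 1 ≤ ρ ^ 2 - 1 := hρsq
    _ = t ^ 2 * ∑ i : Fin 5, τ (Fin.castSucc i) ^ 2 := by rw [hρ2]; ring
    _ ≤ t ^ 2 * ‖τ‖ ^ 2 := by gcongr

/-- The inequality endgame of the push-off lemma (pure norm arithmetic in `ℝ⁶`): a chord `w`
with `‖w - t τ‖ ≤ t² C²`, whose normal component is controlled by `ε ‖d‖` with
`‖d‖ ≤ K (‖w‖ + ε ‖d‖)`, forces `|⟪τ, ν₀⟫| ≤ δ/4` once `ε = δ/(64 K C)` and `t C² < δ/8`.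
[folklore] -/
theorem pushoff_endgame {w τ ν₀ : (EuclideanSpace ℝ (Fin 6))} {t C K δ ε nd : ℝ} (ht : 0 < t) (hC : 0 < C) (hK : 0 <
      K)
    (hδ : 0 < δ) (hδC : δ ≤ C) (hε : ε = δ / (64 * K * C)) (hν₀ : ‖ν₀‖ = 1)
    (hw1 : ‖w - t • τ‖ ≤ t ^ 2 * C ^ 2) (hτC : ‖τ‖ ≤ C) (htC : t * C ≤ 1)
    (hnd : 0 ≤ nd) (hd : nd ≤ K * (‖w‖ + ε * nd)) (hwν : |⟪w, ν₀⟫| ≤ ε * nd)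
    (ht2 : t * C ^ 2 < δ / 8) : |⟪τ, ν₀⟫| ≤ δ / 4 := by
  have hε0 : 0 < ε := by rw [hε]; positivity
  -- `‖w‖ ≤ 2 C t`
  have htC2 : t ^ 2 * C ^ 2 ≤ t * C := by
    have h0 : 0 ≤ t * C := by positivity
    calc t ^ 2 * C ^ 2 = (t * C) * (t * C) := by ring
      _ ≤ (t * C) * 1 := mul_le_mul_of_nonneg_left htC h0
      _ = t * C := mul_one _
  have hw2 : ‖w‖ ≤ 2 * C * t := by
    have h1 : ‖w‖ ≤ ‖w - t • τ‖ + ‖t • τ‖ := norm_le_norm_sub_add _ _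
    rw [norm_smul, Real.norm_of_nonneg ht.le] at h1
    have h2 : t * ‖τ‖ ≤ t * C := by gcongr
    linarith
  -- `nd ≤ 4 K C t`
  have hKε : K * ε ≤ 1 / 2 := by
    rw [hε, show K * (δ / (64 * K * C)) = δ / (64 * C) by field_simp, div_le_iff₀ (by positivity)]
    linarith
  have hnd4 : nd ≤ 4 * K * C * t := by
    have h1 : nd ≤ K * (2 * C * t) + (K * ε) * nd := by nlinarith
    have h2 : (K * ε) * nd ≤ (1 / 2) * nd := mul_le_mul_of_nonneg_right hKε hnd
    linarith
  -- the normal component of the chord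
  have hA : |⟪w, ν₀⟫| ≤ t * (δ / 16) := by
    refine hwν.trans ?_
    calc ε * nd ≤ ε * (4 * K * C * t) := by gcongr
      _ = t * (δ / 16) := by rw [hε]; field_simp; ring
  have hsplit : t * ⟪τ, ν₀⟫ = ⟪w, ν₀⟫ - ⟪w - t • τ, ν₀⟫ := by
    rw [inner_sub_left, real_inner_smul_left]; ring
  have hB : |⟪w - t • τ, ν₀⟫| ≤ t * (δ / 8) := by
    refine (abs_real_inner_le_norm _ _).trans ?_
    rw [hν₀, mul_one]
    refine hw1.trans ?_
    nlinarith
  have hmain : t * |⟪τ, ν₀⟫| ≤ t * (δ / 16) + t * (δ / 8) := by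
    rw [← abs_of_pos ht, ← abs_mul, abs_of_pos ht, hsplit]
    have := abs_sub ⟪w, ν₀⟫ ⟪w - t • τ, ν₀⟫
    linarith
  have : |⟪τ, ν₀⟫| ≤ δ / 16 + δ / 8 := by
    have h := le_of_mul_le_mul_left (by linarith : t * |⟪τ, ν₀⟫| ≤ t * (δ / 16 + δ / 8)) ht
    exact h
  linarith

end Normalisation

/-- Marker of part 4 (registered sub-goal `stub_fluxIdentity_part4`): `‖z'‖² = ∑_{i<5} zᵢ²`
(`norm_truncL_sq`). [folklore] -/
theorem stub_fluxIdentity_part4 :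
    ∀ z : EuclideanSpace ℝ (Fin 6), ‖Literature.Geometry.Riemannian.SphericalCylinderEntropy.truncL
      z‖ ^ 2 = ∑ i : Fin 5, z (Fin.castSucc i) ^ 2 :=
  fun z => norm_truncL_sq z

end Summit.SmoothPoincare4.SmoothPoincare4.Theorems.CylinderRungTwo.KillingFlux
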